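import Mathlib
import HarnessLib
import Literature.Analysis.FluidPDE.Tao2016AveragedNS.LocalCascadeSolutions
import Literature.Analysis.FluidPDE.Tao2016AveragedNS.RenormalisedCascadeWaves
import Summits.NavierStokesRegularity.NavierStokesRegularity.Theorems.TaoLadderRungTwoBreakEternalRigidityViscBddOneDefs
import Summits.NavierStokesRegularity.NavierStokesRegularity.Theorems.TaoLadderRungTwoBreakEternalRigidityViscBddOneFiringFloor
import Summits.NavierStokesRegularity.NavierStokesRegularity.Theorems.TaoLadderRungTwoBreakEternalRigidityViscBddOneCriticalRate
import Summits.NavierStokesRegularity.NavierStokesRegularity.Theorems.WakeRatchetMinimalViscousBlowupClosedValve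

/-!
# Crux `TaoLadderRungTwoBreak.EternalRigidityViscBddOne` (stmt-NavierStokesRegularity-20420): the CRITICAL FRONT of a viscous blow-up —
# it exists at every time, it ESCAPES TO INFINITY, and the covariant viscosity of the frame recentred at it is `ν̂ ≍ ν/√(front level)`
# (recentring anchor for the (ω4) extraction `stub_eternalLimitViscBdd`)

MODEL lattice ODEs only (Tao 2016 §4: the exact NS-scaled `ν`-viscous cascade lattice of a table of `InTableClass R`, `m = 4`, from a
one-shell datum, in the registered vocabulary `ViscousUpTo` / `BlowsUpAt` / `TypeOne` of the skeleton `85fbfe8e90eea58b`); nothing here is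
a statement about the Navier–Stokes equations; no stub, crux or summit is closed (`--supports stmt-NavierStokesRegularity-20420`).

The minimal-rate theorem (`CriticalRate.typeOne_quantity_lower_bound`: along `ViscousUpTo ∧ BlowsUpAt` some mode has
`Λ^F|X_{i,F}(t)|(t⋆−t) ≥ c⋆ := 1/(32(3+Λ))` at every `t < t⋆`) singles out, at every time, CRITICAL-FRONT modes `(i, F)`.  This file
records the two facts an ω-limit extraction recentred at the critical front needs BEFORE any clock:
* `criticalFront_nonneg` / `exists_criticalFront` — a critical-front mode sits at a shell `F ≥ 0` (shells below `0` are empty), and one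
  exists at every `t < t⋆`;
* `criticalFront_escapes` — **the front escapes to infinity**: for every `K₀` there is `t₁ < t⋆` such that every critical-front mode at a time
  `t ∈ [t₁, t⋆)` has `F ≥ K₀` (each fixed shell has `|X_{i,F}| ≤ (Σ_j X₀ⱼ²)^{1/2}` by the energy bound, so `Λ^F|X_{i,F}|(t⋆−t) → 0`);
* `frameViscosity_eq` / `frameViscosity_le_of_front` / `le_frameViscosity_of_typeOne` — the covariant viscosity
  `ν̂(F,t) = ν(1+ε₀)^{2F}(t⋆−t)` of the renormalised frame recentred at `(F, t)` (`isEternalVisc_recentre`, tree) satisfies the identity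
  `ν̂(F,t)·((1+ε₀)^{F/2}|X_{i,F}(t)|) = ν·(Λ^F|X_{i,F}(t)|(t⋆−t))`; hence at a critical-front mode `ν̂ ≥ c⋆ν/((1+ε₀)^{F/2}|X_{i,F}|)` and
  under `TypeOne` (constant `C`) `ν̂ ≤ Cν/((1+ε₀)^{F/2}|X_{i,F}|)` at EVERY charged mode: `ν̂ ≍ ν/√ℓ` with `ℓ = (1+ε₀)^F X_{i,F}²` the a=1
  level of the anchor — the record dichotomy of evidence #42 in front language (anchor levels bounded ⟺ a `ν̂ > 0` limit is possible;
  anchor levels `→ ∞` ⟺ the limit is inviscid).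
HONEST LABEL: bookkeeping on top of `…CriticalRate`; (ω3), (ω4), ⟨20420⟩ and every NS statement remain OPEN; rung 0.
-/

noncomputable section

-- the summit and its single sub-problem share the name (CONVENTIONS §1)
set_option linter.dupNamespace false

open Set Filter Topology
open Literature.Analysis.FluidPDE Literature.Analysis.FluidPDE.TaoCascade
open Summit.NavierStokesRegularity.NavierStokesRegularity.Theorems.MinimalViscousBlowup.ThresholdRay
open Summit.NavierStokesRegularity.NavierStokesRegularity.Theorems.EternalRigidityViscBddOne.Birth
open Summit.NavierStokesRegularity.NavierStokesRegularity.Theorems.EternalRigidityViscBddOne.FiringFloor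
open Summit.NavierStokesRegularity.NavierStokesRegularity.Theorems.EternalRigidityViscBddOne.CriticalRate

namespace Summit.NavierStokesRegularity.NavierStokesRegularity.Theorems.EternalRigidityViscBddOne.CriticalFront

/-! ### Critical-front modes exist and sit at nonnegative shells -/

/-- A mode carrying a positive type-I quantity `c ≤ Λ^F|X_{i,F}(t)|(t⋆−t)` (`c > 0`) along a `ViscousUpTo` trajectory sits at a shell
`F ≥ 0`: the shells below `0` are empty.  MODEL lattice only.
[cite: Tao2016AveragedNS, §4 Lemma 4.1 (4.11); cell vocabulary (stmt-NavierStokesRegularity-20420)] -/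
theorem criticalFront_nonneg {ε₀ ν : ℝ} {α : Fin 4 → Fin 4 → Fin 4 → ℤ × ℤ × ℤ → ℝ} {X₀ : Fin 4 → ℝ}
    {X : Fin 4 → ℤ → ℝ → ℝ} {tStar : ℝ} (hV : ViscousUpTo ε₀ ν α X₀ X tStar) {t c : ℝ} (hc : 0 < c) (ht0 : 0 ≤ t)
    (htT : t < tStar) {i : Fin 4} {F : ℤ} (hF : c ≤ bigLam ε₀ ^ F * |X i F t| * (tStar - t)) : 0 ≤ F := by
  by_contra hneg
  push Not at hneg
  rw [hV.noLow i F t hneg ht0 htT, abs_zero, mul_zero, zero_mul] at hF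
  exact absurd hF (not_le.2 hc)

/-- **A critical-front mode exists at every time** of a viscous blow-up: `∃ i, ∃ F ≥ 0, Λ^F|X_{i,F}(t)|(t⋆−t) ≥ 1/(32(3+Λ))`.
[cite: Teschl2012, §2.6; Tao2016AveragedNS, §4 (4.8), Lemma 4.1 (4.5), (4.11); cell vocabulary (stmt-NavierStokesRegularity-20420)] -/
theorem exists_criticalFront {R ε₀ ν : ℝ} (hε₀ : 0 < ε₀) (hν : 0 < ν)
    {α : Fin 4 → Fin 4 → Fin 4 → ℤ × ℤ × ℤ → ℝ} (hα : InTableClass R α) {X₀ : Fin 4 → ℝ}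
    {X : Fin 4 → ℤ → ℝ → ℝ} {tStar : ℝ} (hV : ViscousUpTo ε₀ ν α X₀ X tStar) (hB : BlowsUpAt ε₀ X tStar) :
    ∀ t : ℝ, 0 ≤ t → t < tStar → ∃ (i : Fin 4) (F : ℤ), 0 ≤ F ∧
      1 / (32 * (3 + bigLam ε₀)) ≤ bigLam ε₀ ^ F * |X i F t| * (tStar - t) := by
  intro t ht0 htT
  have hΛ : 0 < bigLam ε₀ := bigLam_pos (by linarith)
  obtain ⟨i, F, hF⟩ := typeOne_quantity_lower_bound hε₀ hν hα hV hB t ht0 htT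
  exact ⟨i, F, criticalFront_nonneg hV (by positivity) ht0 htT hF, hF⟩

/-! ### The critical front escapes to infinity -/

/-- **THE CRITICAL FRONT ESCAPES TO INFINITY.**  Along a viscous blow-up (`ViscousUpTo`, table of `InTableClass R`, `ν > 0`), for every
`K₀` there is `t₁ < t⋆` such that at every time `t ∈ [t₁,t⋆)` every mode with `Λ^F|X_{i,F}(t)|(t⋆−t) ≥ 1/(32(3+Λ))` has `F ≥ K₀`: a fixed
shell has `|X_{i,F}(t)| ≤ (Σ_j X₀ⱼ²)^{1/2}` (energy bound `shellEnergy_le_datum_of_viscousUpTo`), so its type-I quantity is `O(t⋆−t)`.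
[cite: Tao2016AveragedNS, §4 proof of (4.13), Lemma 4.1 (4.5), (4.11); cell vocabulary (stmt-NavierStokesRegularity-20420)] -/
theorem criticalFront_escapes {R ε₀ ν : ℝ} (hε₀ : 0 < ε₀) (hν : 0 < ν)
    {α : Fin 4 → Fin 4 → Fin 4 → ℤ × ℤ × ℤ → ℝ} (hα : InTableClass R α) {X₀ : Fin 4 → ℝ}
    {X : Fin 4 → ℤ → ℝ → ℝ} {tStar : ℝ} (hV : ViscousUpTo ε₀ ν α X₀ X tStar) :
    ∀ K₀ : ℤ, ∃ t₁ : ℝ, t₁ < tStar ∧ ∀ t : ℝ, 0 ≤ t → t₁ ≤ t → t < tStar → ∀ (i : Fin 4) (F : ℤ),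
      1 / (32 * (3 + bigLam ε₀)) ≤ bigLam ε₀ ^ F * |X i F t| * (tStar - t) → K₀ ≤ F := by
  intro K₀
  have hl1 : (1 : ℝ) ≤ 1 + ε₀ := by linarith
  have hΛ : 0 < bigLam ε₀ := bigLam_pos (by linarith)
  have hΛ1 : 1 ≤ bigLam ε₀ := by
    unfold bigLam
    exact Real.one_le_rpow (by linarith) (by norm_num)
  set S : ℝ := Real.sqrt (∑ j : Fin 4, X₀ j ^ 2) with hSdef
  have hS0 : 0 ≤ S := Real.sqrt_nonneg _
  set c : ℝ := 1 / (32 * (3 + bigLam ε₀)) with hcdef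
  have hc : 0 < c := by rw [hcdef]; positivity
  -- the threshold time
  set d : ℝ := c / (bigLam ε₀ ^ K₀ * (S + 1)) with hddef
  have hD : 0 < bigLam ε₀ ^ K₀ * (S + 1) := mul_pos (zpow_pos hΛ _) (by linarith)
  have hd : 0 < d := div_pos hc hD
  refine ⟨tStar - d, by linarith, fun t ht0 ht1 htT i F hF => ?_⟩
  by_contra hlt
  push Not at hlt
  -- a low shell: `Λ^F ≤ Λ^{K₀}` and `|X_{i,F}(t)| ≤ S`
  have hzpow : bigLam ε₀ ^ F ≤ bigLam ε₀ ^ K₀ := zpow_le_zpow_right₀ hΛ1 hlt.le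
  have hX : |X i F t| ≤ S := by
    have h1 := abs_apply_le_norm_shellVec X F t i
    have h2 := shellEnergy_le_datum_of_viscousUpTo hε₀ hν hα hV F t ht0 htT
    have h3 : ‖shellVec X F t‖ ≤ S := by
      rw [hSdef, ← Real.sqrt_sq (norm_nonneg (shellVec X F t))]
      exact Real.sqrt_le_sqrt h2
    exact h1.trans h3
  have hTt : tStar - t ≤ d := by linarith
  have hTt0 : 0 ≤ tStar - t := by linarith
  have hle : bigLam ε₀ ^ F * |X i F t| * (tStar - t) ≤ bigLam ε₀ ^ K₀ * S * d := by
    have h1 : bigLam ε₀ ^ F * |X i F t| ≤ bigLam ε₀ ^ K₀ * S :=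
      mul_le_mul hzpow hX (abs_nonneg _) (zpow_nonneg hΛ.le _)
    exact mul_le_mul h1 hTt hTt0 (mul_nonneg (zpow_nonneg hΛ.le _) hS0)
  have hlt' : bigLam ε₀ ^ K₀ * S * d < c := by
    rw [hddef]
    have hK : 0 < bigLam ε₀ ^ K₀ := zpow_pos hΛ _
    calc bigLam ε₀ ^ K₀ * S * (c / (bigLam ε₀ ^ K₀ * (S + 1)))
        = c * (S / (S + 1)) := by field_simp
      _ < c * 1 := mul_lt_mul_of_pos_left (by rw [div_lt_one (by linarith)]; linarith) hc
      _ = c := mul_one c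
  exact absurd (hF.trans hle) (not_le.2 hlt')

/-! ### The covariant viscosity of the frame recentred at a mode -/

/-- **Frame viscosity identity.**  For `ε₀ > −1` and any mode `(i,F)` at time `t`:
`ν(1+ε₀)^{2F}(t⋆−t) · ((1+ε₀)^{F/2}|X_{i,F}(t)|) = ν · (Λ^F|X_{i,F}(t)|(t⋆−t))` (`Λ^F = (1+ε₀)^{5F/2} = (1+ε₀)^{2F}(1+ε₀)^{F/2}`): the
covariant viscosity `ν̂ = ν(1+ε₀)^{2F}(t⋆−t)` of the renormalised frame recentred at `(F,t)` times the square root of the a=1 level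
`(1+ε₀)^F X_{i,F}²` is `ν ×` the type-I quantity.
[cite: Tao2016AveragedNS, §4 (4.1), the viscous equation before Thm. 4.2, §6.4; cell vocabulary (`isEternalVisc_recentre`)] -/
theorem frameViscosity_eq {ε₀ : ℝ} (hε : -1 < ε₀) (ν tStar t : ℝ) (X : Fin 4 → ℤ → ℝ → ℝ) (i : Fin 4) (F : ℤ) :
    ν * (1 + ε₀) ^ ((2 : ℝ) * F) * (tStar - t) * ((1 + ε₀) ^ (F / 2 : ℝ) * |X i F t|) =
      ν * (bigLam ε₀ ^ F * |X i F t| * (tStar - t)) := by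
  have hl0 : (0 : ℝ) < 1 + ε₀ := by linarith
  have hP : bigLam ε₀ ^ F = (1 + ε₀) ^ ((2 : ℝ) * F) * (1 + ε₀) ^ (F / 2 : ℝ) := by
    rw [bigLam, ← Real.rpow_intCast, ← Real.rpow_mul hl0.le, ← Real.rpow_add hl0]
    congr 1
    ring
  rw [hP]
  ring

/-- **Lower bound on the frame viscosity at a critical-front mode.**  If `c ≤ Λ^F|X_{i,F}(t)|(t⋆−t)` with `X_{i,F}(t) ≠ 0`, then
`ν̂ = ν(1+ε₀)^{2F}(t⋆−t) ≥ c·ν/((1+ε₀)^{F/2}|X_{i,F}(t)|)`: a bounded anchor LEVEL keeps the frame viscosity away from `0`.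
[cite: Tao2016AveragedNS, §4 (4.1), §6.4; cell vocabulary (stmt-NavierStokesRegularity-20420)] -/
theorem le_frameViscosity_of_front {ε₀ ν tStar t c : ℝ} (hε : -1 < ε₀) (hν : 0 ≤ ν) {X : Fin 4 → ℤ → ℝ → ℝ}
    {i : Fin 4} {F : ℤ} (hX : X i F t ≠ 0) (hF : c ≤ bigLam ε₀ ^ F * |X i F t| * (tStar - t)) :
    c * ν / ((1 + ε₀) ^ (F / 2 : ℝ) * |X i F t|) ≤ ν * (1 + ε₀) ^ ((2 : ℝ) * F) * (tStar - t) := by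
  have hl0 : (0 : ℝ) < 1 + ε₀ := by linarith
  have hq : 0 < (1 + ε₀) ^ (F / 2 : ℝ) * |X i F t| := mul_pos (Real.rpow_pos_of_pos hl0 _) (abs_pos.2 hX)
  rw [div_le_iff₀ hq, frameViscosity_eq hε]
  nlinarith

/-- **Upper bound on the frame viscosity under TYPE I.**  If `Λ^F|X_{i,F}(t)|(t⋆−t) ≤ C` with `X_{i,F}(t) ≠ 0`, then
`ν̂ = ν(1+ε₀)^{2F}(t⋆−t) ≤ C·ν/((1+ε₀)^{F/2}|X_{i,F}(t)|)`: the frame viscosity at ANY charged mode of a type-I trajectory is at most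
`Cν/√ℓ`, `ℓ` the a=1 level of the mode — it tends to `0` along anchors whose level diverges (inviscid limit), and stays bounded along
anchors whose level is bounded below (the firing floor).
[cite: Tao2016AveragedNS, §4 (4.1), §6.4; cell vocabulary (stmt-NavierStokesRegularity-20420, `TypeOne`)] -/
theorem frameViscosity_le_of_typeOne {ε₀ ν tStar t C : ℝ} (hε : -1 < ε₀) (hν : 0 ≤ ν) {X : Fin 4 → ℤ → ℝ → ℝ}
    {i : Fin 4} {F : ℤ} (hX : X i F t ≠ 0) (hC : bigLam ε₀ ^ F * |X i F t| * (tStar - t) ≤ C) :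
    ν * (1 + ε₀) ^ ((2 : ℝ) * F) * (tStar - t) ≤ C * ν / ((1 + ε₀) ^ (F / 2 : ℝ) * |X i F t|) := by
  have hl0 : (0 : ℝ) < 1 + ε₀ := by linarith
  have hq : 0 < (1 + ε₀) ^ (F / 2 : ℝ) * |X i F t| := mul_pos (Real.rpow_pos_of_pos hl0 _) (abs_pos.2 hX)
  rw [le_div_iff₀ hq, frameViscosity_eq hε]
  nlinarith

/-- **The two-sided frame viscosity at the critical front of a type-I viscous blow-up.**  `ViscousUpTo ∧ BlowsUpAt ∧ TypeOne` (table of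
`InTableClass R`, `ν > 0`): at every `t < t⋆` there is a mode `(i,F)`, `F ≥ 0`, `X_{i,F}(t) ≠ 0`, whose recentred frame has covariant
viscosity pinned to the inverse square root of its a=1 level: `c⋆ν/q ≤ ν(1+ε₀)^{2F}(t⋆−t) ≤ Cν/q`, `q = (1+ε₀)^{F/2}|X_{i,F}(t)|`,
`c⋆ = 1/(32(3+Λ))`, `C` the type-I constant.  MODEL lattice only.
[cite: Tao2016AveragedNS, §4 (4.1), §6.4; Teschl2012, §2.6; cell vocabulary (stmt-NavierStokesRegularity-20420)] -/
theorem criticalFront_frameViscosity {R ε₀ ν : ℝ} (hε₀ : 0 < ε₀) (hν : 0 < ν)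
    {α : Fin 4 → Fin 4 → Fin 4 → ℤ × ℤ × ℤ → ℝ} (hα : InTableClass R α) {X₀ : Fin 4 → ℝ}
    {X : Fin 4 → ℤ → ℝ → ℝ} {tStar : ℝ} (hV : ViscousUpTo ε₀ ν α X₀ X tStar) (hB : BlowsUpAt ε₀ X tStar)
    (hT1 : TypeOne ε₀ X tStar) :
    ∃ C : ℝ, ∀ t : ℝ, 0 ≤ t → t < tStar → ∃ (i : Fin 4) (F : ℤ), 0 ≤ F ∧ X i F t ≠ 0 ∧
      1 / (32 * (3 + bigLam ε₀)) * ν / ((1 + ε₀) ^ (F / 2 : ℝ) * |X i F t|) ≤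
          ν * (1 + ε₀) ^ ((2 : ℝ) * F) * (tStar - t) ∧
        ν * (1 + ε₀) ^ ((2 : ℝ) * F) * (tStar - t) ≤ C * ν / ((1 + ε₀) ^ (F / 2 : ℝ) * |X i F t|) := by
  obtain ⟨C, hC⟩ := hT1
  have hε : (-1 : ℝ) < ε₀ := by linarith
  refine ⟨C, fun t ht0 htT => ?_⟩
  obtain ⟨i, F, hF0, hF⟩ := exists_criticalFront hε₀ hν hα hV hB t ht0 htT
  have hX : X i F t ≠ 0 := by
    intro h0
    rw [h0, abs_zero, mul_zero, zero_mul] at hF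
    have : (0 : ℝ) < 1 / (32 * (3 + bigLam ε₀)) := by
      have := bigLam_pos hε; positivity
    linarith
  exact ⟨i, F, hF0, hX, le_frameViscosity_of_front hε hν.le hX hF,
    frameViscosity_le_of_typeOne hε hν.le hX (hC t ht0 htT i F)⟩

end Summit.NavierStokesRegularity.NavierStokesRegularity.Theorems.EternalRigidityViscBddOne.CriticalFront

end
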